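import Summits.Ventures.CertifiedArithmetic.Expansions.Orient2dEstimate
import Literature.ComputerArithmetic.Shewchuk1997.FastExpansionSum
import Literature.ComputerArithmetic.JeannerodRump2018.OptimalBound
import Mathlib.Tactic.Linarith
import Mathlib.Tactic.Positivity
import Mathlib.Tactic.Ring
import Mathlib.Tactic.FieldSimp
import Mathlib.Tactic.LinearCombination
import Mathlib.Tactic.NormNum

/-!
# APPROXIMATE under round-to-even at FIXED precision: the chain family

HONEST FRAMING. New work of this programme (Ventures), not a published result. Companions:
`EstimateThreeQuartersLowerBound` (three-term families erring by `(3/4 − u/4)·u·2^s`: `3/4` is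
sharp UNIFORMLY in `p`) and `EstimateThreeQuarters` (staged: always `< (3/4)·u·2^s`). Left open
there: how close to `3/4` the ratio `|estimate − Σ|/(u·2^s)` gets at a FIXED precision `p`. HERE:
for every `p ≥ 2` it comes as close as one likes (`fixedPrecision_ratio_sup`) to
  `S(p) = (3·2^p − 2)/(2^(p+2) − 2) = 3/4 − 1/(2^(p+3) − 4)`  (`5/7, 11/15, 23/31, 47/63, …`).
That `S(p)` IS the supremum at precision `p` is our CONJECTURE, not proved here (evidence below).

CHAIN FAMILY `chainExpansion p n = ⟨c₀, …, cₙ, (2^p − 1)·W, 2^p·W⟩`: `cₖ = −(2^p − 1)·2^((p+1)k)`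
(full significands of ones a clear bit apart), `W = 2^((p+1)(n+1))`, `s = (p+1)(n+2)`, `u·2^s = 2W`.
* SWALLOWING (`roundTiesEven_chainTerm_add`): `cₖ ⊕ cₖ₊₁ = cₖ₊₁`, `cₙ ⊕ (2^p − 1)·W = (2^p − 1)·W`,
  as `|cₖ|` is just below half the unit in the last place of the next component: the running
  word forgets the whole chain, of mass `(2^p − 1)(W − 1)/(2^(p+1) − 1)` (`sum_chain`).
* THE TIE (`roundTiesEven_pred_mul`): `(2^p − 1)·W + 2^p·W = (2^(p+1) − 1)·W` is the midpoint of
  the consecutive floats `(2^p − 1)·2W`, `2^p·2W` with ODD floor significand `2^p − 1`, so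
  round-to-even rounds UP by `W = u·2^s/2` — the same direction (chain negative, pair positive).
So `estimate = 2^s`, `|estimate − Σ| = (S(p) − (2^p − 1)/((2^(p+2) − 2)·W))·u·2^s ↑ S(p)·u·2^s`
(`estimate_roundTiesEven_chainExpansion`). Instances: `chainExpansion 2 2 = ⟨−3, −24, −192, 1536,
2048⟩ ↦ 4096 = Σ + 731` (`0.7139·u·2^s`); binary64, `n = 1` (four floats): error `(3/4 − 2^-56 −
2^-109)·u·2^s`, beyond the three-term family's `(3/4 − 2^-55)·u·2^s` (`chainExpansion_binary64`).

EVIDENCE FOR `sup = S(p)`: exhaustive search (seat file `work/rne/check_hinfN.c`) over all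
nonoverlapping lists of `≤ N` floats of `p` bits below `2^E`, all signs, round-to-even; maximum
of `|estimate − Σ|/(u·2^s)`: `p = 2` (`N, E = 8, 13`): `0.713867 = 731/1024`, ATTAINED BY
`chainExpansion 2 2` (`−3` split as `−1 − 2`); `p = 3` (`9, 18`): `0.733307` (`S = 0.733333`;
`chainExpansion 3 3` gives `0.733330` but needs `E = 20`); `p = 4` (`8, 16`): `0.741699 =
1519/2048`, exactly the value of `chainExpansion 4 1` (`S = 0.741935`); `p = 5` (`7, 13`):
`0.742188` (`S = 0.746032`); `p = 1` (`8, 12`): `0.666504` (`2/3`; the family needs `p ≥ 2`).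
Never above `S(p)`. Heuristic: a final top-binade tie gives at most `u·2^s/2` and lands on an ODD
word, whose inherited error is a sum of roundoffs down a ladder of ratio `≥ 2^(p+1)`. Open.
Reference: J. R. Shewchuk, Discrete Comput. Geom. 18 (1997) 305–363, §2.1, §2.7 [Shewchuk1997].
-/

namespace Summit.Ventures.CertifiedArithmetic.Expansions

open Literature.ComputerArithmetic.JeannerodRump2018 (IsFloat IsRoundNearest unitRoundoff)
open Literature.ComputerArithmetic.BoldoJeannerodMelquiondMuller2023 (roundTiesEven ulp
  ulp_of_ne_zero isRoundNearest_roundTiesEven roundTiesEven_of_tie_of_odd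
  fl_eq_of_abs_sub_lt_half_ulp)
open Literature.ComputerArithmetic.Shewchuk1997

variable {p : ℕ} {emin : ℤ}

/-- The `k`-th CHAIN TERM `cₖ = −(2^p − 1)·2^((p+1)k)`: a full significand of ones. -/
def chainTerm (p k : ℕ) : ℚ := -(((2 : ℚ) ^ p - 1) * 2 ^ ((p + 1) * k))

/-- THE CHAIN FAMILY `⟨c₀, …, cₙ, −cₙ₊₁, 2^((p+1)(n+1) + p)⟩` (smallest first; `n + 3` components
below `2^s`, `s = (p+1)(n+2)`; the closing pair is `(2^p − 1)·W, 2^p·W`, `W = 2^((p+1)(n+1))`). -/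
def chainExpansion (p n : ℕ) : List ℚ :=
  (List.range (n + 1)).map (chainTerm p) ++
    [-chainTerm p (n + 1), (2 : ℚ) ^ ((p + 1) * (n + 1) + p)]

/-! ### Rounding tools: ulp on a binade, absorption, the tie -/

/-- `estimate (l ++ [x]) = estimate l ⊕ x` for nonempty `l` (the fold law of `estimate`). -/
private theorem estimate_snoc (fl : ℚ → ℚ) {l : List ℚ} (hl : l ≠ []) (x : ℚ) :
    estimate fl (l ++ [x]) = fl (estimate fl l + x) := by
  obtain ⟨e, es, rfl⟩ := List.exists_cons_of_ne_nil hl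
  simp [estimate, List.foldl_append]

/-- `ulp = 2^e` on the binade `2^(e+p−1) ≤ |x| < 2^(e+p)` (`emin ≤ 0 ≤ e`). -/
private theorem ulp_binade (hemin : emin ≤ 0) {e : ℕ} {x : ℚ}
    (hlo : (2 : ℚ) ^ (e + p) ≤ 2 * |x|) (hhi : |x| < (2 : ℚ) ^ (e + p)) :
    ulp p emin x = (2 : ℚ) ^ e := by
  have hpow : (0 : ℚ) < 2 ^ (e + p) := by positivity
  have hpos : 0 < |x| := by linarith
  have hz : ((2 : ℕ) : ℚ) ^ (((e + p : ℕ) : ℤ) - 1) * 2 = 2 ^ (e + p) := by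
    rw [Nat.cast_ofNat, ← zpow_add_one₀ two_ne_zero, sub_add_cancel, zpow_natCast]
  have hlog : Int.log 2 |x| = ((e + p : ℕ) : ℤ) - 1 := by
    apply le_antisymm
    · have h' : |x| < ((2 : ℕ) : ℚ) ^ (((e + p : ℕ) : ℤ) - 1 + 1) := by
        rw [sub_add_cancel, zpow_natCast, Nat.cast_ofNat]; exact hhi
      have := (Int.lt_zpow_iff_log_lt (b := 2) (by norm_num) hpos).mp h'
      omega
    · have h' : ((2 : ℕ) : ℚ) ^ (((e + p : ℕ) : ℤ) - 1) ≤ |x| := by linarith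
      exact (Int.zpow_le_iff_le_log (b := 2) (by norm_num) hpos).mp h'
  rw [ulp_of_ne_zero (abs_pos.mp hpos), hlog, max_eq_right (by omega),
    show ((e + p : ℕ) : ℤ) - 1 - p + 1 = (e : ℕ) by push_cast; ring, zpow_natCast]

/-- ABSORPTION. A nearest rounding returns the float `c` on `x + c` when `2(|c| − |x|) ≥ 2^(e+p)`
and `|x| + |c| < 2^(e+p)` (so `x + c` lies in the binade of unit `2^e`) and `2|x| < 2^e`. -/
private theorem rte_absorb (hp : 1 ≤ p) (hemin : emin ≤ 0) {e : ℕ} {x c : ℚ}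
    (hc : IsFloat p emin c) (hlo : (2 : ℚ) ^ (e + p) ≤ 2 * (|c| - |x|))
    (hhi : |x| + |c| < (2 : ℚ) ^ (e + p)) (hx : 2 * |x| < (2 : ℚ) ^ e) :
    roundTiesEven p emin (x + c) = c := by
  have h1 := abs_sub_abs_le_abs_sub c (-x)
  rw [abs_neg, sub_neg_eq_add, add_comm c x] at h1
  refine fl_eq_of_abs_sub_lt_half_ulp hp (isRoundNearest_roundTiesEven hp) hc ?_
  rw [ulp_binade hemin (by linarith) (by linarith [abs_add_le x c]), add_sub_cancel_right]; linarith

/-- THE TIE RULE AT WORK. `RNₑ((2^(p+1) − 1)·2^e) = 2^(p+1)·2^e`: the argument is the midpoint of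
the consecutive floats `(2^p − 1)·2^(e+1)` and `2^p·2^(e+1)` (`ulp = 2^(e+1)` on the binade
`[2^(e+p), 2^(e+p+1))`), and `⌊·/ulp⌋ = 2^p − 1` is ODD: round-to-even rounds up, by `2^e`. -/
theorem roundTiesEven_pred_mul (hp : 1 ≤ p) (hemin : emin ≤ 0) (e : ℕ) :
    roundTiesEven p emin (((2 : ℚ) ^ (p + 1) - 1) * 2 ^ e) = 2 ^ (p + 1) * 2 ^ e := by
  obtain ⟨q, rfl⟩ : ∃ q, p = q + 1 := ⟨p - 1, by omega⟩
  have hq1 : (1 : ℚ) ≤ 2 ^ q := one_le_pow₀ (by norm_num)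
  have h2e : (0 : ℚ) < 2 ^ e := by positivity
  set y : ℚ := ((2 : ℚ) ^ (q + 1 + 1) - 1) * 2 ^ e with hy
  have hP : (2 : ℚ) ^ (q + 1 + 1) = 4 * 2 ^ q := by ring
  have hP' : (2 : ℚ) ^ (e + 1 + (q + 1)) = 2 ^ e * (4 * 2 ^ q) := by rw [← hP]; ring
  have hqe : (0 : ℚ) ≤ 2 ^ e * (4 * 2 ^ q - 2) := mul_nonneg h2e.le (by linarith)
  have hypos : 0 < y := by rw [hy, hP]; nlinarith
  have hu : ulp (q + 1) emin y = 2 ^ (e + 1) := by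
    refine ulp_binade hemin ?_ ?_ <;> rw [abs_of_pos hypos, hy, hP, hP'] <;> nlinarith
  have hN : ⌊y / ulp (q + 1) emin y⌋ = 2 * 2 ^ q - 1 := by
    rw [hu, show y / 2 ^ (e + 1) = 2 * 2 ^ q - 1 / 2 by rw [hy, hP, pow_succ]; field_simp; ring,
      Int.floor_eq_iff]; push_cast; constructor <;> linarith
  have hodd : Odd ⌊y / ulp (q + 1) emin y⌋ := by rw [hN]; exact ⟨2 ^ q - 1, by ring⟩
  have htie : y - (⌊y / ulp (q + 1) emin y⌋ : ℚ) * ulp (q + 1) emin y =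
      ((⌊y / ulp (q + 1) emin y⌋ : ℚ) + 1) * ulp (q + 1) emin y - y := by
    rw [hN, hu, hy, hP, pow_succ]; push_cast; ring
  rw [(roundTiesEven_of_tie_of_odd htie hodd).1, hN, hu, hP, pow_succ]; push_cast; ring

/-- `|cₖ| = (2^p − 1)·2^((p+1)k)`, and `2·|cₖ| < 2^((p+1)(k+1))`: a chain term is less than half
the unit of the next scale. -/
theorem abs_chainTerm (p k : ℕ) : |chainTerm p k| = ((2 : ℚ) ^ p - 1) * 2 ^ ((p + 1) * k) ∧
    2 * |chainTerm p k| < (2 : ℚ) ^ ((p + 1) * (k + 1)) := by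
  have h1 : (1 : ℚ) ≤ 2 ^ p := one_le_pow₀ (by norm_num)
  have hX : (0 : ℚ) < 2 ^ ((p + 1) * k) := by positivity
  have habs : |chainTerm p k| = ((2 : ℚ) ^ p - 1) * 2 ^ ((p + 1) * k) := by
    unfold chainTerm; rw [abs_neg, abs_of_nonneg (mul_nonneg (by linarith) hX.le)]
  exact ⟨habs, by rw [habs, Nat.mul_succ, pow_add, pow_succ]; nlinarith⟩

/-- Chain terms are `p`-bit floats (`emin ≤ 0`). -/
theorem chainTerm_isFloat (hemin : emin ≤ 0) (p k : ℕ) : IsFloat p emin (chainTerm p k) := by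
  have h1 : (1 : ℤ) ≤ 2 ^ p := one_le_pow₀ (by norm_num)
  refine ⟨-(2 ^ p - 1), (((p + 1) * k : ℕ) : ℤ), ?_, by omega, ?_⟩
  · rw [abs_neg, abs_of_nonneg (by linarith)]; linarith
  · unfold chainTerm; rw [zpow_natCast]; push_cast; ring

/-- SWALLOWING (`p ≥ 2`). `cₖ ⊕ c = c` for every float `c` with `|c| = (2^p − 1)·2^((p+1)(k+1))`
— that is, for `c = ±cₖ₊₁`: `|cₖ|` is less than half the unit in the last place `2^((p+1)(k+1))`
of `c`, and `cₖ + c` stays in the binade of `c` (this is where `p ≥ 2` enters: `(2^p − 1)·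
(2^(p+1) − 1) ≥ 2^(2p)` fails for `p = 1`). No tie occurs: every nearest rounding agrees. -/
theorem roundTiesEven_chainTerm_add (hp : 2 ≤ p) (hemin : emin ≤ 0) (k : ℕ) {c : ℚ}
    (hc : IsFloat p emin c) (hca : |c| = ((2 : ℚ) ^ p - 1) * 2 ^ ((p + 1) * (k + 1))) :
    roundTiesEven p emin (chainTerm p k + c) = c := by
  have hP : (4 : ℚ) ≤ 2 ^ p :=
    le_trans (by norm_num) (pow_le_pow_right₀ (by norm_num) hp : (2 : ℚ) ^ 2 ≤ 2 ^ p)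
  obtain ⟨hck, -⟩ := abs_chainTerm p k
  set P : ℚ := 2 ^ p with hPdef
  set X : ℚ := 2 ^ ((p + 1) * k) with hXdef
  have hX : 0 < X := by positivity
  have hPX : 0 < P * X := by positivity
  have hsucc : (2 : ℚ) ^ ((p + 1) * (k + 1)) = 2 * P * X := by
    rw [Nat.mul_succ, pow_add, pow_succ]; ring
  rw [hsucc] at hca
  have hk1 : 0 ≤ (P - 4) * (P - 4) * X := by positivity
  have hk2 : 0 ≤ (P - 4) * X := mul_nonneg (by linarith) hX.le
  refine rte_absorb (by omega) hemin (e := (p + 1) * (k + 1)) hc ?_ ?_ ?_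
  · rw [pow_add, hsucc, hca, hck]; nlinarith
  · rw [pow_add, hsucc, hca, hck]; nlinarith
  · rw [hsucc, hck]; nlinarith

/-- THE RUNNING WORD ALONG THE CHAIN is its last term: `estimate ⟨c₀, …, cₙ⟩ = cₙ`. -/
theorem estimate_chain (hp : 2 ≤ p) (hemin : emin ≤ 0) (n : ℕ) :
    estimate (roundTiesEven p emin) ((List.range (n + 1)).map (chainTerm p)) = chainTerm p n := by
  induction n with
  | zero => simp [List.range_succ, estimate]
  | succ n ih =>
    have hne : (List.range (n + 1)).map (chainTerm p) ≠ [] := List.ne_nil_of_length_pos (by simp)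
    rw [List.range_succ, List.map_append, List.map_cons, List.map_nil, estimate_snoc _ hne, ih]
    exact roundTiesEven_chainTerm_add hp hemin n (chainTerm_isFloat hemin p (n + 1))
      (abs_chainTerm p (n + 1)).1

/-- THE SWALLOWED MASS: `(2^(p+1) − 1)·(c₀ + ⋯ + cₙ) = −(2^p − 1)·(2^((p+1)(n+1)) − 1)`. -/
theorem sum_chain (p n : ℕ) : ((2 : ℚ) ^ (p + 1) - 1) * ((List.range (n + 1)).map (chainTerm p)).sum
      = -(((2 : ℚ) ^ p - 1) * (2 ^ ((p + 1) * (n + 1)) - 1)) := by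
  induction n with
  | zero => simp [List.range_succ, chainTerm]; ring
  | succ n ih =>
    have hsucc : (2 : ℚ) ^ ((p + 1) * (n + 1 + 1)) = 2 ^ ((p + 1) * (n + 1)) * (2 * 2 ^ p) := by
      rw [Nat.mul_succ, pow_add, pow_succ]; ring
    rw [List.range_succ, List.map_append, List.map_cons, List.map_nil, List.sum_append,
      List.sum_cons, List.sum_nil, add_zero, mul_add, ih, hsucc]
    unfold chainTerm; ring

/-- THE LAST ADDITION is the tie of `roundTiesEven_pred_mul`:
`−cₙ₊₁ ⊕ 2^p·W = RNₑ((2^(p+1) − 1)·W) = 2^(p+1)·W = 2^s` (`W = 2^((p+1)(n+1))`). -/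
theorem roundTiesEven_closing (hp : 1 ≤ p) (hemin : emin ≤ 0) (n : ℕ) :
    roundTiesEven p emin (-chainTerm p (n + 1) + 2 ^ ((p + 1) * (n + 1) + p))
      = 2 ^ ((p + 1) * (n + 2)) := by
  rw [show -chainTerm p (n + 1) + (2 : ℚ) ^ ((p + 1) * (n + 1) + p)
      = ((2 : ℚ) ^ (p + 1) - 1) * 2 ^ ((p + 1) * (n + 1)) by
        unfold chainTerm; rw [pow_add 2 ((p + 1) * (n + 1)) p, pow_succ 2 p]; ring,
    roundTiesEven_pred_mul hp hemin, show (p + 1) * (n + 2) = (p + 1) * (n + 1) + (p + 1) by ring,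
    pow_add]; ring

/-! ### The chain family -/

/-- `estimate (chainExpansion p n) = 2^((p+1)(n+2)) = 2^s` under round-to-even (`p ≥ 2`). -/
theorem estimate_chainExpansion (hp : 2 ≤ p) (hemin : emin ≤ 0) (n : ℕ) :
    estimate (roundTiesEven p emin) (chainExpansion p n) = 2 ^ ((p + 1) * (n + 2)) := by
  unfold chainExpansion
  rw [show ∀ (l : List ℚ) (a b : ℚ), l ++ [a, b] = l ++ [a] ++ [b] from fun l a b => by simp,
    estimate_snoc _ (by simp), estimate_snoc _ (List.ne_nil_of_length_pos (by simp)),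
    estimate_chain hp hemin,
    roundTiesEven_chainTerm_add hp hemin n (chainTerm_isFloat hemin p (n + 1)).neg
      (by rw [abs_neg, (abs_chainTerm p (n + 1)).1]), roundTiesEven_closing (by omega) hemin]

/-- All components of the chain family are `p`-bit floats (`emin ≤ 0`, `p ≥ 1`). -/
theorem chainExpansion_isFloat (hp : 1 ≤ p) (hemin : emin ≤ 0) (n : ℕ) :
    ∀ x ∈ chainExpansion p n, IsFloat p emin x := by
  intro x hx
  unfold chainExpansion at hx
  rcases List.mem_append.mp hx with hx | hx
  · obtain ⟨k, -, rfl⟩ := List.mem_map.mp hx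
    exact chainTerm_isFloat hemin p k
  · simp only [List.mem_cons, List.not_mem_nil, or_false] at hx
    rcases hx with rfl | rfl
    · exact (chainTerm_isFloat hemin p (n + 1)).neg
    · refine ⟨1, (((p + 1) * (n + 1) + p : ℕ) : ℤ), ?_, by omega, by rw [zpow_natCast]; simp⟩
      rw [abs_one]; exact one_lt_pow₀ (by norm_num) (by omega)

/-- `x` lies 1-below `r·2^t` as soon as `|x| < 2^t` ([Shewchuk1997] §2.1 nonoverlapping). -/
private theorem below_one_of_abs_lt {x : ℚ} {t : ℕ} (r : ℤ) (hx : |x| < (2 : ℚ) ^ t) :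
    Below 1 x ((r : ℚ) * 2 ^ t) :=
  ⟨t, ⟨r, by rw [zpow_natCast]⟩, by rw [one_mul, zpow_natCast]; exact hx⟩

/-- **THE CHAIN FAMILY IS A NONOVERLAPPING EXPANSION**: sorted by magnitude, every component
1-below every later one. -/
theorem chainExpansion_isExpansion (p n : ℕ) : IsExpansion 1 (chainExpansion p n) := by
  have h2 : (1 : ℚ) < 2 := by norm_num
  have hct : ∀ k t : ℕ, (p + 1) * (k + 1) ≤ t → |chainTerm p k| < (2 : ℚ) ^ t := fun k t hkt =>
    lt_of_lt_of_le (by linarith [(abs_chainTerm p k).2, abs_nonneg (chainTerm p k)])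
      (pow_le_pow_right₀ h2.le hkt)
  have eN : ∀ (k : ℕ) (σ : ℤ), (σ : ℚ) * chainTerm p k
      = (((-σ * (2 ^ p - 1) : ℤ)) : ℚ) * 2 ^ ((p + 1) * k) := fun k σ => by
    unfold chainTerm; push_cast; ring
  have eT : (2 : ℚ) ^ ((p + 1) * (n + 1) + p) = ((1 : ℤ) : ℚ) * 2 ^ ((p + 1) * (n + 1) + p) :=
    by simp
  unfold IsExpansion chainExpansion
  rw [List.pairwise_append]
  refine ⟨?_, ?_, ?_⟩
  · rw [List.pairwise_map]
    refine List.pairwise_lt_range.imp fun {k k'} hkk' => ?_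
    rw [← one_mul (chainTerm p k'), ← Int.cast_one, eN]
    exact below_one_of_abs_lt _ (hct k _ (Nat.mul_le_mul_left _ hkk'))
  · rw [List.pairwise_pair, eT]
    refine below_one_of_abs_lt 1 ?_
    have hW : (0 : ℚ) < 2 ^ ((p + 1) * (n + 1)) := by positivity
    rw [abs_neg, (abs_chainTerm p (n + 1)).1, pow_add]
    nlinarith
  · intro x hx y hy
    obtain ⟨k, hk, rfl⟩ := List.mem_map.mp hx
    have hkn : k < n + 1 := List.mem_range.mp hk
    simp only [List.mem_cons, List.not_mem_nil, or_false] at hy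
    rcases hy with rfl | rfl
    · rw [neg_eq_neg_one_mul, ← Int.cast_one, ← Int.cast_neg, eN]
      exact below_one_of_abs_lt _ (hct k _ (Nat.mul_le_mul_left _ hkn))
    · rw [eT]
      exact below_one_of_abs_lt _ (hct k _ ((Nat.mul_le_mul_left _ hkn).trans (by omega)))

/-- Every component lies below `2^s`, `s = (p+1)(n+2)` (the top one is `2^(s−1)`). -/
theorem chainExpansion_abs_lt (p n : ℕ) :
    ∀ x ∈ chainExpansion p n, |x| < (2 : ℚ) ^ ((p + 1) * (n + 2)) := by
  have h2 : (1 : ℚ) < 2 := by norm_num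
  have hct : ∀ k, k < n + 2 → |chainTerm p k| < (2 : ℚ) ^ ((p + 1) * (n + 2)) := fun k hk =>
    lt_of_lt_of_le (b := (2 : ℚ) ^ ((p + 1) * (k + 1)))
      (by linarith [(abs_chainTerm p k).2, abs_nonneg (chainTerm p k)])
      (pow_le_pow_right₀ h2.le (Nat.mul_le_mul_left (p + 1) hk))
  intro x hx
  unfold chainExpansion at hx
  rcases List.mem_append.mp hx with hx | hx
  · obtain ⟨k, hk, rfl⟩ := List.mem_map.mp hx
    exact hct k (by have := List.mem_range.mp hk; omega)
  · simp only [List.mem_cons, List.not_mem_nil, or_false] at hx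
    rcases hx with rfl | rfl
    · rw [abs_neg]; exact hct (n + 1) (by omega)
    · rw [abs_of_pos (by positivity)]
      refine pow_lt_pow_right₀ h2 ?_
      rw [show (p + 1) * (n + 2) = (p + 1) * (n + 1) + (p + 1) by ring]; omega

/-- THE ERROR, exactly: `(2^(p+1) − 1)·(estimate − Σ) = (2^(p+1) − 1)·W + (2^p − 1)(W − 1)`,
`W = 2^((p+1)(n+1)) = u·2^s/2`: the tie's `W` plus the swallowed mass. -/
theorem chainExpansion_error (hp : 2 ≤ p) (hemin : emin ≤ 0) (n : ℕ) :
    ((2 : ℚ) ^ (p + 1) - 1) *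
        (estimate (roundTiesEven p emin) (chainExpansion p n) - (chainExpansion p n).sum)
      = ((2 : ℚ) ^ (p + 1) - 1) * 2 ^ ((p + 1) * (n + 1))
          + ((2 : ℚ) ^ p - 1) * (2 ^ ((p + 1) * (n + 1)) - 1) := by
  have hS := sum_chain p n
  rw [estimate_chainExpansion hp hemin]
  unfold chainExpansion
  rw [List.sum_append, List.sum_cons, List.sum_cons, List.sum_nil, add_zero, pow_add,
    show -chainTerm p (n + 1) = (2 ^ p - 1) * 2 ^ ((p + 1) * (n + 1)) by unfold chainTerm; ring,
    show (p + 1) * (n + 2) = (p + 1) * (n + 1) + (p + 1) by ring, pow_add]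
  linear_combination (-1 : ℚ) * hS

/-- **THE CHAIN FAMILY AT PRECISION `p`.** For every `p ≥ 2`, `emin ≤ 0` and `n`,
`chainExpansion p n` is a nonoverlapping expansion of `n + 3` floats of `F(p, emin)` with components
below `2^s`, `s = (p+1)(n+2)`, `u·2^s = 2^((p+1)(n+1)+1)`, on which APPROXIMATE with round-to-even
returns `2^s` and errs by EXACTLY `(S(p) − (2^p − 1)/((2^(p+2) − 2)·2^((p+1)(n+1))))·u·2^s`. -/
theorem estimate_roundTiesEven_chainExpansion (hp : 2 ≤ p) (hemin : emin ≤ 0) (n : ℕ) :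
    (∀ x ∈ chainExpansion p n, IsFloat p emin x) ∧ IsExpansion 1 (chainExpansion p n) ∧
    (∀ x ∈ chainExpansion p n, |x| < (2 : ℚ) ^ ((p + 1) * (n + 2))) ∧
    unitRoundoff p * 2 ^ ((p + 1) * (n + 2)) = 2 ^ ((p + 1) * (n + 1) + 1) ∧
    estimate (roundTiesEven p emin) (chainExpansion p n) = 2 ^ ((p + 1) * (n + 2)) ∧
    |estimate (roundTiesEven p emin) (chainExpansion p n) - (chainExpansion p n).sum|
      = ((3 * 2 ^ p - 2) / (2 ^ (p + 2) - 2)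
          - (2 ^ p - 1) / ((2 ^ (p + 2) - 2) * 2 ^ ((p + 1) * (n + 1))))
        * 2 ^ ((p + 1) * (n + 1) + 1) := by
  have h1 : (2 : ℚ) ≤ 2 ^ p := le_self_pow₀ (by norm_num) (by omega)
  have hE := chainExpansion_error hp hemin n
  set W : ℚ := 2 ^ ((p + 1) * (n + 1)) with hW
  have hW1 : 1 ≤ W := one_le_pow₀ (by norm_num)
  have hD : (2 : ℚ) ^ (p + 1) - 1 ≠ 0 := by rw [pow_succ]; nlinarith
  have hD2 : (2 : ℚ) ^ (p + 2) - 2 ≠ 0 := by rw [pow_add]; nlinarith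
  refine ⟨chainExpansion_isFloat (by omega) hemin n, chainExpansion_isExpansion p n,
    chainExpansion_abs_lt p n, ?_, estimate_chainExpansion hp hemin n, ?_⟩
  · unfold unitRoundoff
    rw [show (p + 1) * (n + 2) = (p + 1) * (n + 1) + 1 + p by ring, pow_add]
    field_simp
  set E : ℚ := estimate (roundTiesEven p emin) (chainExpansion p n) - (chainExpansion p n).sum
  have hEq : E = ((2 ^ (p + 1) - 1) * W + (2 ^ p - 1) * (W - 1)) / (2 ^ (p + 1) - 1) :=
    eq_div_of_mul_eq hD (by rw [mul_comm]; exact hE)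
  have hW0 : W ≠ 0 := by positivity
  have hPW : 0 ≤ (2 ^ p - 2) * (W - 1) := mul_nonneg (by linarith) (by linarith)
  have hE0 : 0 ≤ E := by rw [hEq, pow_succ]; exact div_nonneg (by nlinarith) (by nlinarith)
  rw [abs_of_nonneg hE0, hEq,
    show (2 : ℚ) ^ ((p + 1) * (n + 1) + 1) = 2 * W by rw [pow_succ, hW]; ring]
  field_simp
  ring

/-- **THE RATIO STAYS BELOW `S(p)` AND CONVERGES TO IT.** For `p ≥ 2`, `emin ≤ 0`: along the chain
family `|estimate − Σ| < S(p)·u·2^s`, and for every `c < S(p)` some member has `|estimate − Σ| >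
c·u·2^s` — so the least `C` with `|estimate l − Σ l| ≤ C·u·2^s` for all nonoverlapping expansions
of `F(p, emin)` is at least `S(p) = 3/4 − 1/(2^(p+3) − 4)` (that it IS `S(p)` is conjectural;
that it is at most `3/4` is `EstimateThreeQuarters`). -/
theorem fixedPrecision_ratio_sup (hp : 2 ≤ p) (hemin : emin ≤ 0) :
    (∀ n : ℕ, |estimate (roundTiesEven p emin) (chainExpansion p n) - (chainExpansion p n).sum|
      < (3 * 2 ^ p - 2) / (2 ^ (p + 2) - 2) * (unitRoundoff p * 2 ^ ((p + 1) * (n + 2)))) ∧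
    ∀ c : ℚ, c < (3 * 2 ^ p - 2) / (2 ^ (p + 2) - 2) → ∃ l : List ℚ,
      (∀ x ∈ l, IsFloat p emin x) ∧ IsExpansion 1 l ∧ ∃ s : ℕ, (∀ x ∈ l, |x| < (2 : ℚ) ^ s) ∧
        c * (unitRoundoff p * 2 ^ s) < |estimate (roundTiesEven p emin) l - l.sum| := by
  have h1 : (2 : ℚ) ≤ 2 ^ p := le_self_pow₀ (by norm_num) (by omega)
  have hD2 : (0 : ℚ) < 2 ^ (p + 2) - 2 := by rw [pow_add]; nlinarith
  have hA : (0 : ℚ) < 2 ^ p - 1 := by linarith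
  refine ⟨fun n => ?_, fun c hc => ?_⟩
  · obtain ⟨-, -, -, hu, -, he⟩ := estimate_roundTiesEven_chainExpansion hp hemin n
    rw [he, hu]
    have : (0 : ℚ) < (2 ^ p - 1) / ((2 ^ (p + 2) - 2) * 2 ^ ((p + 1) * (n + 1))) := by positivity
    have h2W : (0 : ℚ) < 2 ^ ((p + 1) * (n + 1) + 1) := by positivity
    nlinarith
  · set S : ℚ := (3 * 2 ^ p - 2) / (2 ^ (p + 2) - 2) with hS
    have hSc : 0 < S - c := by linarith
    obtain ⟨n, hn⟩ := pow_unbounded_of_one_lt ((2 ^ p - 1) / ((2 ^ (p + 2) - 2) * (S - c)))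
      (by norm_num : (1 : ℚ) < 2)
    obtain ⟨-, -, -, hu, -, he⟩ := estimate_roundTiesEven_chainExpansion hp hemin n
    refine ⟨chainExpansion p n, chainExpansion_isFloat (by omega) hemin n,
      chainExpansion_isExpansion p n, (p + 1) * (n + 2), chainExpansion_abs_lt p n, ?_⟩
    rw [he, hu]
    have h2W : (0 : ℚ) < 2 ^ ((p + 1) * (n + 1) + 1) := by positivity
    have hnW : (2 : ℚ) ^ n ≤ 2 ^ ((p + 1) * (n + 1)) :=
      pow_le_pow_right₀ (by norm_num) (by nlinarith)
    have hlt : (2 ^ p - 1) / ((2 ^ (p + 2) - 2) * 2 ^ ((p + 1) * (n + 1))) < S - c := by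
      have hm := mul_le_mul_of_nonneg_left hnW (mul_pos hSc hD2).le
      rw [div_lt_iff₀ (by positivity)]
      rw [div_lt_iff₀ (by positivity)] at hn
      nlinarith
    nlinarith

/-- `p = 2`, `n = 2`: `⟨−3, −24, −192, 1536, 2048⟩ ↦ 4096 = Σ + 731` (`u·2^s = 1024`; `731/1024
= 0.7139 < 5/7`): the exhaustive maximum over expansions of `≤ 8` two-bit floats below `2^13`. -/
theorem chainExpansion_two_two (hemin : emin ≤ 0) :
    chainExpansion 2 2 = [-3, -24, -192, 1536, 2048] ∧
    estimate (roundTiesEven 2 emin) (chainExpansion 2 2) = 4096 ∧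
    (chainExpansion 2 2).sum = 3365 := by
  have hl : chainExpansion 2 2 = [-3, -24, -192, 1536, 2048] := by
    simp [chainExpansion, chainTerm, List.range_succ]; norm_num
  exact ⟨hl, by rw [estimate_chainExpansion le_rfl hemin]; norm_num, by rw [hl]; norm_num⟩

/-- binary64, `n = 1`: on the four floats `−(2^53 − 1)`, `−(2^53 − 1)·2^54`, `(2^53 − 1)·2^108`,
`2^161` APPROXIMATE returns `2^162 = Σ + (3·2^107 − 2^53 − 1)`: an error of `(3/4 − 2^-56 −
2^-109)·u·2^s` (`u·2^s = 2^109`), beyond the three-term family's `(3/4 − 2^-55)·u·2^s`. -/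
theorem chainExpansion_binary64 (hemin : emin ≤ 0) :
    estimate (roundTiesEven 53 emin) (chainExpansion 53 1) = 2 ^ 162 ∧
    estimate (roundTiesEven 53 emin) (chainExpansion 53 1) - (chainExpansion 53 1).sum
      = 3 * 2 ^ 107 - 2 ^ 53 - 1 ∧
    (3 * 2 ^ 107 - 2 ^ 53 - 1 : ℚ) = (3 / 4 - 1 / 2 ^ 56 - 1 / 2 ^ 109) * 2 ^ 109 := by
  have he := estimate_chainExpansion (p := 53) (by norm_num) hemin 1
  have hE := chainExpansion_error (p := 53) (by norm_num) hemin 1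
  norm_num at he hE ⊢
  exact ⟨he, by linarith⟩

end Summit.Ventures.CertifiedArithmetic.Expansions
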